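import Summits.ABC.ABC.Theorems.IneffectiveSubspaceDepthCountedABCStubLwDeepDictionaryLemmas
import Summits.ABC.ABC.Theorems.IneffectiveSubspaceDepthCountedABCStubFibreBaker

/-!
# Stub `stub_lwDeepDictionary` of line `Sketch` — crux `IneffectiveSubspace.DepthCountedABC` (stmt-ABC-14938)

THE LW-DEEP DICTIONARY `LWDeep K → SmallFullSizeCell K`.

* Hypothesis (`LWDeep K`, unfolded; of Lang–Waldschmidt strength and OPEN — it is only ASSUMED, as
  the antecedent of the implication): a lower bound for linear forms `Λ = Σ_{i∈s} u_i · log x_i` in at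
  most `4 + K` logarithms of positive rationals, polynomial in the coefficient height
  `B = max(1, max_i |u_i|)` and of exponent `1 + ε` in the multiplicative height
  `H = ∏_i |num x_i| · den x_i`: for every `ε > 0` some `C > 0`, `M ≥ 0` with
  `C⁻¹ · B^(−M) · H^(−(1+ε)) ≤ |Λ|` whenever `Λ ≠ 0`.
* Conclusion (`SmallFullSizeCell K`, unfolded): abc with the member `a` at FULL SIZE on the cell
  `ω₅(abc) := #{p : v_p(abc) ≥ 5} ≤ K`: for every `δ > 0` some `C > 0` with
  `c < C · (a · rad(bc))^(1+δ)` on every abc triple `(a, b, c)` of the cell.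

WHAT.  `stub_lwDeepDictionary : ∀ K, LWDeep K → SmallFullSizeCell K` (both sides unfolded, exactly
as registered in the skeleton of the line).

PROOF.  Fix `δ > 0` and put `ε = η = δ/(2+δ)`, so that `1 − η = 1/(1+δ/2)` and
`(1+ε)(1+δ/2) = 1+δ`.  Take `C, M` from the hypothesis at `ε`, and `A` with
`B^M ≤ A · c^η` for all real `c ≥ 2`, `0 ≤ B ≤ 4 + log c/log 2` (`lwDeepDict_coeff_rpow_le`:
`B ≤ 3t`, `t = 2 log c/log 2 ≥ 2`, and `t^M ≤ A₀ c^η` is the landed `fibreBaker_logpow_le`).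
For an abc triple `(a, b, c)` of the cell, the DEPTH-GROUPED FORM of the landed
`stub_lwDeepDictionaryLemmas` has `#s ≤ 4 + ω₅(abc) ≤ 4 + K` logarithms of positive rationals, value
`log c − log b ∈ (0, a/b]` (`0 < b < c`, `log t ≤ t − 1`), height EXACTLY `rad(bc)` and coefficients
`|u_i| ≤ 4 + log₂ c ≤ 4 + log c/log 2`.  The hypothesis therefore reads
`C⁻¹ B^(−M) rad(bc)^(−(1+ε)) ≤ a/b`, i.e. `b ≤ a · C · B^M · rad(bc)^(1+ε)` (`stub_lwDeepDictionary`),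
and the real bookkeeping `lwDeepDict_absorb` finishes: `b ≤ C A · a rad(bc)^(1+ε) · c^η`,
`c = a + b ≤ M₁ · a rad(bc)^(1+ε) · c^η` with `M₁ = 1 + C A`, extraction
`c^(1−η) = c^(1/(1+δ/2)) ≤ M₁ a rad(bc)^(1+ε)`, and raising to the power `1 + δ/2`,
`c ≤ M₁^(1+δ/2) · a^(1+δ/2) · rad(bc)^(1+δ) ≤ M₁^(1+δ/2) · (a rad(bc))^(1+δ) < (M₁^(1+δ/2) + 1) · (a rad(bc))^(1+δ)`.

Sources: skeleton `Cruxes/DepthCountedABC/Lines/Sketch.lean` of lead `prover-line-stmt-ABC-14938-0`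
(stub 10, `stub_lwDeepDictionary`; card `depth-grouped-four-logarithms`, "Lang–Waldschmidt in
`n = 4 + K` logarithms").  PROVED in the tree and used here:
`Summit.ABC.ABC.Theorems.DepthCountedABC.stub_lwDeepDictionaryLemmas`
(`Theorems/IneffectiveSubspaceDepthCountedABCStubLwDeepDictionaryLemmas.lean`) and
`Summit.ABC.ABC.Theorems.DepthCountedABC.fibreBaker_logpow_le`
(`Theorems/IneffectiveSubspaceDepthCountedABCStubFibreBaker.lean`, whose `fibreBaker_absorb` is the
model of the extraction step).  Mathlib only otherwise (`Real.natLog_le_logb`, `Real.log_div_log`,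
`Real.log_lt_log`, `Real.log_le_sub_one_of_pos`, `Real.rpow_neg`, `Real.rpow_sub`, `Real.rpow_mul`,
`Real.mul_rpow`, `Real.rpow_le_rpow`, `Real.rpow_le_rpow_of_exponent_le`, `Real.one_le_rpow`,
`Finset.sup_le`, `UniqueFactorizationMonoid.radical_ne_zero`).  Deliberately NOT here: the
Lang–Waldschmidt hypothesis `LWDeep K` itself (open, abc-strength), the four-logarithm dictionary
`stub_dictionary` (landed separately), the Ridout/Baker strata, the power-rich residual and the
assembly (the other stubs of the line), and any bookkeeping of the explicit value of `C(K, δ)`.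
-/

-- `Summit.<Summit>.<Problem>` is the mandated summit-side namespace (CONVENTIONS §2); for the
-- single-conjunct summit `ABC` the two coincide, so the duplicate `ABC.ABC` is deliberate.
set_option linter.dupNamespace false

namespace Summit.ABC.ABC.Theorems.DepthCountedABC

open scoped BigOperators
open UniqueFactorizationMonoid (radical)

/-! ### Real analysis: the coefficient height is a power of `log c`, absorbed into `c^η` -/

/-- The integer binary logarithm is below the real one: `log₂ c ≤ log c / log 2`
(`2^(log₂ c) ≤ c`). [folklore] -/
theorem lwDeepDict_natlog_le (c : ℕ) : (Nat.log 2 c : ℝ) ≤ Real.log c / Real.log 2 := by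
  rw [Real.log_div_log]
  exact_mod_cast Real.natLog_le_logb c 2

/-- THE COEFFICIENT HEIGHT IS ABSORBED.  For `M ≥ 0` and `η > 0` there is `A > 0` such that
`B^M ≤ A · c^η` for every real `c ≥ 2` and every `0 ≤ B ≤ 4 + log c / log 2`: with
`t = 2 log c / log 2 ≥ 2` one has `B ≤ 4 + t/2 ≤ 3t`, so `B^M ≤ 3^M · t^M ≤ 3^M · A₀ · c^η` by
`fibreBaker_logpow_le`. [folklore] -/
theorem lwDeepDict_coeff_rpow_le {M η : ℝ} (hM : 0 ≤ M) (hη : 0 < η) :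
    ∃ A : ℝ, 0 < A ∧ ∀ c B : ℝ, 2 ≤ c → 0 ≤ B → B ≤ 4 + Real.log c / Real.log 2 →
      B ^ M ≤ A * c ^ η := by
  obtain ⟨A, hA, hAc⟩ := fibreBaker_logpow_le hM hη
  have hlog2 : 0 < Real.log 2 := Real.log_pos (by norm_num)
  have h3 : (0 : ℝ) ≤ 3 := by norm_num
  refine ⟨(3 : ℝ) ^ M * A, mul_pos (Real.rpow_pos_of_pos (by norm_num) M) hA,
    fun c B hc hB0 hB => ?_⟩
  have hc1 : 1 ≤ c := by linarith
  -- `t := 2 log c / log 2 = 2 · (log c / log 2) ≥ 2`, so `B ≤ 4 + t/2 ≤ 3t`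
  have ht1 : 1 ≤ Real.log c / Real.log 2 := by
    rw [le_div_iff₀ hlog2, one_mul]; exact Real.log_le_log two_pos hc
  have ht : 2 * Real.log c / Real.log 2 = 2 * (Real.log c / Real.log 2) := by ring
  have ht0 : 0 ≤ 2 * Real.log c / Real.log 2 := by rw [ht]; linarith
  have hBt : B ≤ 3 * (2 * Real.log c / Real.log 2) := by rw [ht]; linarith
  calc B ^ M ≤ (3 * (2 * Real.log c / Real.log 2)) ^ M := Real.rpow_le_rpow hB0 hBt hM
    _ = (3 : ℝ) ^ M * (2 * Real.log c / Real.log 2) ^ M := Real.mul_rpow h3 ht0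
    _ ≤ (3 : ℝ) ^ M * (A * c ^ η) :=
        mul_le_mul_of_nonneg_left (hAc c hc1) (Real.rpow_nonneg h3 M)
    _ = (3 : ℝ) ^ M * A * c ^ η := by ring

/-- ABSORPTION AND EXTRACTION (pure real analysis).  For `δ > 0`, `C > 0`, `M ≥ 0` there is `C' > 0`
such that for all real `a, b ≥ 1` with `a + b = c`, all `H ≥ 1` and all `0 ≤ B ≤ 4 + log c / log 2`:
if `b ≤ a · (C · B^M · H^(1+ε))` with `ε = δ/(2+δ)`, then `c < C' · (a · H)^(1+δ)`.  Proof: with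
`η = δ/(2+δ)`, `B^M ≤ A c^η` (`lwDeepDict_coeff_rpow_le`), so `c = a + b ≤ M₁ · a H^(1+ε) · c^η` with
`M₁ = 1 + C A`; extract `c^(1−η) = c^(1/(1+δ/2)) ≤ M₁ a H^(1+ε)` and raise to the power `1 + δ/2`:
`c ≤ M₁^(1+δ/2) · a^(1+δ/2) · H^((1+ε)(1+δ/2)) = M₁^(1+δ/2) · a^(1+δ/2) · H^(1+δ) ≤ M₁^(1+δ/2) · (aH)^(1+δ)`
(`a ≥ 1`), `< (M₁^(1+δ/2) + 1) · (aH)^(1+δ)`. [folklore] -/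
theorem lwDeepDict_absorb {δ C M : ℝ} (hδ : 0 < δ) (hC : 0 < C) (hM : 0 ≤ M) :
    ∃ C' : ℝ, 0 < C' ∧ ∀ a b c H B : ℝ, 1 ≤ a → 1 ≤ b → a + b = c → 1 ≤ H → 0 ≤ B →
      B ≤ 4 + Real.log c / Real.log 2 →
      b ≤ a * (C * B ^ M * H ^ (1 + δ / (2 + δ))) → c < C' * (a * H) ^ (1 + δ) := by
  have hδ2 : 0 < 2 + δ := by linarith
  have hδ1 : 0 < 1 + δ / 2 := by positivity
  set η : ℝ := δ / (2 + δ) with hη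
  have hη0 : 0 < η := div_pos hδ hδ2
  have hη1 : 1 - η = 1 / (1 + δ / 2) := by rw [hη]; field_simp; ring
  have hηδ : (1 + η) * (1 + δ / 2) = 1 + δ := by rw [hη]; field_simp; ring
  obtain ⟨A, hA, hAc⟩ := lwDeepDict_coeff_rpow_le hM hη0
  set M₁ : ℝ := 1 + C * A with hM₁
  have hM₁0 : 0 < M₁ := add_pos_of_pos_of_nonneg one_pos (mul_pos hC hA).le
  refine ⟨M₁ ^ (1 + δ / 2) + 1, add_pos (Real.rpow_pos_of_pos hM₁0 _) one_pos,
    fun a b c H B ha hb habc hH hB0 hB hkey => ?_⟩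
  have ha0 : 0 < a := by linarith
  have hc2 : 2 ≤ c := by linarith
  have hc1 : 1 ≤ c := by linarith
  have hc0 : 0 < c := by linarith
  have hH0 : 0 < H := by linarith
  have hHε0 : 0 < H ^ (1 + η) := Real.rpow_pos_of_pos hH0 _
  have hHε1 : 1 ≤ H ^ (1 + η) := Real.one_le_rpow hH (by linarith)
  have hcη : 1 ≤ c ^ η := Real.one_le_rpow hc1 hη0.le
  -- absorb the coefficient height: `B^M ≤ A c^η`, so `b ≤ C A · a H^(1+η) · c^η`
  have hBM : B ^ M ≤ A * c ^ η := hAc c B hc2 hB0 hB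
  have h3 : b ≤ C * A * (a * H ^ (1 + η)) * c ^ η := by
    calc b ≤ a * (C * B ^ M * H ^ (1 + η)) := hkey
      _ ≤ a * (C * (A * c ^ η) * H ^ (1 + η)) :=
          mul_le_mul_of_nonneg_left (mul_le_mul_of_nonneg_right
            (mul_le_mul_of_nonneg_left hBM hC.le) hHε0.le) ha0.le
      _ = C * A * (a * H ^ (1 + η)) * c ^ η := by ring
  -- `c = a + b ≤ M₁ · a H^(1+η) · c^η`
  have h4 : c ≤ M₁ * (a * H ^ (1 + η)) * c ^ η := by
    have h1 : a ≤ a * H ^ (1 + η) := le_mul_of_one_le_right ha0.le hHε1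
    have h2 : a * H ^ (1 + η) ≤ a * H ^ (1 + η) * c ^ η :=
      le_mul_of_one_le_right (mul_nonneg ha0.le hHε0.le) hcη
    calc c = a + b := habc.symm
      _ ≤ a * H ^ (1 + η) * c ^ η + C * A * (a * H ^ (1 + η)) * c ^ η :=
          add_le_add (h1.trans h2) h3
      _ = M₁ * (a * H ^ (1 + η)) * c ^ η := by rw [hM₁]; ring
  -- extract: `c^(1-η) ≤ M₁ a H^(1+η)` with `1 - η = 1/(1+δ/2)`, then raise to the power `1 + δ/2`
  -- adapted from `Theorems/IneffectiveSubspaceDepthCountedABCStubFibreBaker.lean` (`fibreBaker_absorb`)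
  have h5 : c ^ (1 / (1 + δ / 2)) ≤ M₁ * (a * H ^ (1 + η)) := by
    rw [← hη1, Real.rpow_sub hc0, Real.rpow_one, div_le_iff₀ (Real.rpow_pos_of_pos hc0 η)]
    exact h4
  have h6 : c = (c ^ (1 / (1 + δ / 2))) ^ (1 + δ / 2) := by
    rw [← Real.rpow_mul hc0.le, one_div_mul_cancel hδ1.ne', Real.rpow_one]
  have haH0 : 0 ≤ a * H ^ (1 + η) := mul_nonneg ha0.le hHε0.le
  have h7 : c ≤ M₁ ^ (1 + δ / 2) * (a * H) ^ (1 + δ) :=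
    calc c = (c ^ (1 / (1 + δ / 2))) ^ (1 + δ / 2) := h6
      _ ≤ (M₁ * (a * H ^ (1 + η))) ^ (1 + δ / 2) :=
          Real.rpow_le_rpow (Real.rpow_nonneg hc0.le _) h5 hδ1.le
      _ = M₁ ^ (1 + δ / 2) * (a ^ (1 + δ / 2) * H ^ (1 + δ)) := by
          rw [Real.mul_rpow hM₁0.le haH0, Real.mul_rpow ha0.le hHε0.le, ← Real.rpow_mul hH0.le,
            hηδ]
      _ ≤ M₁ ^ (1 + δ / 2) * (a ^ (1 + δ) * H ^ (1 + δ)) :=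
          mul_le_mul_of_nonneg_left (mul_le_mul_of_nonneg_right
            (Real.rpow_le_rpow_of_exponent_le ha (by linarith)) (Real.rpow_nonneg hH0.le _))
            (Real.rpow_nonneg hM₁0.le _)
      _ = M₁ ^ (1 + δ / 2) * (a * H) ^ (1 + δ) := by rw [Real.mul_rpow ha0.le hH0.le]
  have hpos : 0 < (a * H) ^ (1 + δ) := Real.rpow_pos_of_pos (mul_pos ha0 hH0) _
  calc c ≤ M₁ ^ (1 + δ / 2) * (a * H) ^ (1 + δ) := h7
    _ < M₁ ^ (1 + δ / 2) * (a * H) ^ (1 + δ) + (a * H) ^ (1 + δ) := lt_add_of_pos_right _ hpos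
    _ = (M₁ ^ (1 + δ / 2) + 1) * (a * H) ^ (1 + δ) := by ring

/-! ### The stub -/

/-- **Stub `stub_lwDeepDictionary` (the LW-DEEP DICTIONARY `LWDeep K → SmallFullSizeCell K`) of line
`Sketch`, crux `DepthCountedABC` (stmt-ABC-14938), fully unfolded.**  If for every `ε > 0` some
`C > 0`, `M ≥ 0` give `C⁻¹ · B^(−M) · H^(−(1+ε)) ≤ |Σ_{i∈s} u_i log x_i|` for all linear forms in
`#s ≤ 4 + K` logarithms of positive rationals with nonzero value (`B = max(1, max_i |u_i|)`,
`H = ∏_i |num x_i| · den x_i`), then for every `δ > 0` some `C > 0` gives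
`c < C · (a · rad(bc))^(1+δ)` on every abc triple of the cell `ω₅(abc) ≤ K`: evaluate the hypothesis
at the depth-grouped form of `stub_lwDeepDictionaryLemmas` (value `log c − log b ∈ (0, a/b]`,
height `rad(bc)`, coefficients `≤ 4 + log₂ c`), getting `b ≤ a · C · B^M · rad(bc)^(1+ε)` with
`B ≤ 4 + log c/log 2`, and conclude by the absorption-extraction lemma `lwDeepDict_absorb`
(`ε = δ/(2+δ)`). [folklore] -/
theorem stub_lwDeepDictionary : ∀ K : ℕ,
    (∀ ε : ℝ, 0 < ε → ∃ C M : ℝ, 0 < C ∧ 0 ≤ M ∧ ∀ (s : Finset ℕ) (x : ℕ → ℚ) (u : ℕ → ℤ),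
      s.card ≤ 4 + K → (∀ i ∈ s, 0 < x i) → (∑ i ∈ s, (u i : ℝ) * Real.log ((x i : ℚ) : ℝ)) ≠ 0 →
      C⁻¹ * ((max 1 (s.sup fun i => (u i).natAbs) : ℕ) : ℝ) ^ (-M) *
          ((∏ i ∈ s, (x i).num.natAbs * (x i).den : ℕ) : ℝ) ^ (-(1 + ε)) ≤
        |∑ i ∈ s, (u i : ℝ) * Real.log ((x i : ℚ) : ℝ)|) →
    ∀ δ : ℝ, 0 < δ → ∃ C : ℝ, 0 < C ∧ ∀ a b c : ℕ,
      Literature.NumberTheory.DiophantineGeometry.IsABCTriple a b c →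
      ((a * b * c).primeFactors.filter (fun p => 5 ≤ (a * b * c).factorization p)).card ≤ K →
      (c : ℝ) < C * ((a : ℝ) * ((UniqueFactorizationMonoid.radical (b * c) : ℕ) : ℝ)) ^ (1 + δ) := by
  intro K hLW δ hδ
  have hε : (0 : ℝ) < δ / (2 + δ) := div_pos hδ (by linarith)
  obtain ⟨C, M, hC, hM, hLWC⟩ := hLW (δ / (2 + δ)) hε
  obtain ⟨C', hC', hmain⟩ := lwDeepDict_absorb hδ hC hM
  refine ⟨C', hC', fun a b c habc hK => ?_⟩
  -- the depth-grouped form of the triple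
  obtain ⟨s, x, u, hcard, hpos, hΛ, hH, hcoef⟩ := stub_lwDeepDictionaryLemmas a b c habc
  obtain ⟨ha, hb, hsum, -⟩ := habc
  have hc : 0 < c := by omega
  have hbR : (0 : ℝ) < b := by exact_mod_cast hb
  have hcR : (0 : ℝ) < c := by exact_mod_cast hc
  -- its value `log c - log b` lies in `(0, a/b]`
  have hΛpos : 0 < Real.log c - Real.log b :=
    sub_pos.mpr (Real.log_lt_log hbR (by exact_mod_cast (show b < c by omega)))
  have hne : (∑ i ∈ s, (u i : ℝ) * Real.log ((x i : ℚ) : ℝ)) ≠ 0 := by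
    rw [hΛ]; exact hΛpos.ne'
  -- adapted from `Theorems/IneffectiveSubspaceDepthCountedABCStubDictionary.lean` (`stub_dictionary`)
  have hba : Real.log c - Real.log b ≤ (a : ℝ) / b := by
    rw [← Real.log_div hcR.ne' hbR.ne']
    calc Real.log ((c : ℝ) / b) ≤ (c : ℝ) / b - 1 := Real.log_le_sub_one_of_pos (div_pos hcR hbR)
      _ = (a : ℝ) / b := by rw [← hsum, Nat.cast_add, add_div, div_self hbR.ne']; ring
  -- feed the form to the hypothesis: `#s ≤ 4 + ω₅(abc) ≤ 4 + K`
  have key := hLWC s x u (hcard.trans (Nat.add_le_add_left hK 4)) hpos hne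
  rw [hΛ, abs_of_pos hΛpos, hH] at key
  replace key := key.trans hba
  -- the coefficient height `B = max(1, max |u_i|)` satisfies `1 ≤ B ≤ 4 + log₂ c ≤ 4 + log c/log 2`
  have hB : max 1 (s.sup fun i => (u i).natAbs) ≤ 4 + Nat.log 2 c :=
    max_le (by omega) (Finset.sup_le hcoef)
  have hB1 : (1 : ℝ) ≤ ((max 1 (s.sup fun i => (u i).natAbs) : ℕ) : ℝ) := by
    exact_mod_cast le_max_left _ _
  have hB0 : (0 : ℝ) ≤ ((max 1 (s.sup fun i => (u i).natAbs) : ℕ) : ℝ) := zero_le_one.trans hB1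
  have hBR : ((max 1 (s.sup fun i => (u i).natAbs) : ℕ) : ℝ) ≤ 4 + Real.log c / Real.log 2 :=
    calc ((max 1 (s.sup fun i => (u i).natAbs) : ℕ) : ℝ) ≤ ((4 + Nat.log 2 c : ℕ) : ℝ) :=
          Nat.cast_le.mpr hB
      _ = 4 + (Nat.log 2 c : ℝ) := by norm_num
      _ ≤ 4 + Real.log c / Real.log 2 := by have := lwDeepDict_natlog_le c; linarith
  -- the height `H = rad(bc) ≥ 1`
  have hHpos : 0 < radical (b * c) := Nat.pos_of_ne_zero UniqueFactorizationMonoid.radical_ne_zero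
  have hH0 : (0 : ℝ) < ((radical (b * c) : ℕ) : ℝ) := by exact_mod_cast hHpos
  have hH1 : (1 : ℝ) ≤ ((radical (b * c) : ℕ) : ℝ) := by exact_mod_cast hHpos
  -- `key` becomes `b ≤ a · (C · B^M · H^(1+ε))`
  rw [Real.rpow_neg hB0, Real.rpow_neg hH0.le, ← mul_inv, ← mul_inv, inv_eq_one_div,
    div_le_div_iff₀ (mul_pos (mul_pos hC (Real.rpow_pos_of_pos (one_pos.trans_le hB1) M))
      (Real.rpow_pos_of_pos hH0 _)) hbR, one_mul] at key
  -- real bookkeeping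
  have hceq : (a : ℝ) + b = c := by exact_mod_cast hsum
  exact hmain a b c _ _ (by exact_mod_cast ha) (by exact_mod_cast hb) hceq hH1 hB0 hBR key

end Summit.ABC.ABC.Theorems.DepthCountedABC
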